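import Literature.NumberTheory.Automorphic.TwistedQuotientIndFunShapiroNatural
import HarnessLib

/-!
# Cohomology of a directed union of lattices, injectivity half: a class dying in the union dies at
# a finite stage

Topic `NumberTheory/Automorphic`; namespace `Literature.NumberTheory.Automorphic.TwistedQuotient`.
Theorems only; no definition, no named fact, no instance, no `sorry`.

Companion of `TwistedQuotientIndFunShapiroNatural.exists_map_indFunMap_eq_of_directed` (the
SURJECTIVITY half of "`H^q(Γ, indFun σ_N) = lim→ H^q(Γ, indFun σ_{N_i})` for `N = ⋃ N_i` a
directed union of `L`-subrepresentations, finitely many `Γ`-orbits on `𝒢 ⧸ L`, stabilisers of type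
`FP_∞`").  Here the INJECTIVITY half (`exists_map_indFunMap_eq_zero_of_directed`): a class of
`H^q(Γ, indFun σ_{N_i})` whose image in `H^q(Γ, indFun σ_N)` vanishes already vanishes in
`H^q(Γ, indFun σ_{N_j})` for some `j ≥ i`.  Proof: orbitwise by Brown VIII (4.6)
(`ResolutionComparison.exists_map_eq_zero_of_directed`), a common stage `j` by directedness
(the transition maps compose, `transition_comp`, as the `φ_i` are injective), and the components
detect classes (`indToOrbitCohomologyNat_pi_bijective`, naturality
`indToOrbitCohomologyNat_map_indFunMap`).

Use ([Scholze2015, §V.4, proof of Thm. V.4.1]): with `N_i = p^{-i} M` this says that the kernel of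
`H^q(X_U, M̃) → H^q(X_U, Ṽ)` is `p`-power torsion, so that an eigenclass of `H^q(X_U, Ṽ)` coming
from `H^q(X_U, M̃)` has a `p`-power multiple which is an exact eigenclass of `H^q(X_U, M̃)`.

## References

* K. S. Brown, *Cohomology of Groups*, GTM 87 (1982), VIII (4.6). [Brown1982CohomologyGroups]
* P. Scholze, Ann. of Math. 182 (2015), §V.4, proof of Thm. V.4.1. [Scholze2015]
-/

noncomputable section

open CategoryTheory
open scoped Classical
open Literature.Algebra.Homology

universe u

namespace Literature.NumberTheory.Automorphic

namespace TwistedQuotient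

variable {A : Type u} [CommRing A] {Γ 𝒢 : Type u} [Group Γ] [Group 𝒢] (ι : Γ →* 𝒢)
  (L : Subgroup 𝒢) {N : Type u} [AddCommGroup N] [Module A N] (σ : Representation A L N)

variable {ι' : Type*} [Preorder ι'] [IsDirected ι' (· ≤ ·)] [Nonempty ι']
  {Nst : ι' → Type u} [∀ i, AddCommGroup (Nst i)] [∀ i, Module A (Nst i)]
  (σst : ∀ i, Representation A L (Nst i))
  (φ : ∀ i, (σst i).IntertwiningMap σ) (hinj : ∀ i, Function.Injective (φ i))
  (t : ∀ ⦃i j⦄, i ≤ j → (σst i).IntertwiningMap (σst j))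
  (ht : ∀ ⦃i j⦄ (h : i ≤ j) (v : Nst i), φ j (t h v) = φ i v)
  (hcovN : ∀ v : N, ∃ i, ∃ w : Nst i, φ i w = v)

omit [IsDirected ι' (· ≤ ·)] [Nonempty ι'] in
include hinj ht in
/-- The transition maps compose: `t_{jl} ∘ t_{ij} = t_{il}` (the `φ_l` are injective). [folklore] -/
theorem transition_comp {i j l : ι'} (hij : i ≤ j) (hjl : j ≤ l) (v : Nst i) :
    t hjl (t hij v) = t (hij.trans hjl) v :=
  hinj l (by rw [ht, ht, ht])

include hinj ht hcovN in
/-- **Per orbit, injectivity half**: a class of `H^q(Γ_x, N_i)` dying in `H^q(Γ_x, N)` dies in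
some `H^q(Γ_x, N_j)`, `j ≥ i`, when `Γ_x` is of type `FP_∞`.
[cite: Brown1982CohomologyGroups, VIII (4.6)] -/
theorem exists_map_indStabMap_eq_zero_of_directed (g₀ : 𝒢)
    (Px : ProjectiveResolution (Rep.trivial A (orbitStabilizer ι L (g₀ : 𝒢 ⧸ L)) A))
    (hPx : ∀ n, ∃ m : ℕ, Nonempty (Px.complex.X n ≅
      Rep.free A (orbitStabilizer ι L (g₀ : 𝒢 ⧸ L)) (Fin m)))
    (q : ℕ) (i : ι') (y : groupCohomology (indStabilizerRep ι L (σst i) g₀) q)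
    (hy : groupCohomology.map (MonoidHom.id _) (indStabMap ι L (σst i) σ g₀ (φ i)) q y = 0) :
    ∃ j, ∃ h : i ≤ j,
      groupCohomology.map (MonoidHom.id _) (indStabMap ι L (σst i) (σst j) g₀ (t h)) q y = 0 :=
  ResolutionComparison.exists_map_eq_zero_of_directed Px hPx
    (A := fun i => indStabilizerRep ι L (σst i) g₀) (B := indStabilizerRep ι L σ g₀)
    (fun i => indStabMap ι L (σst i) σ g₀ (φ i))
    (fun i => indStabMap_injective ι L (σst i) σ g₀ (φ i) (hinj i))
    (fun i j h => indStabMap ι L (σst i) (σst j) g₀ (t h))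
    (fun _ _ h => Rep.hom_ext (Representation.IntertwiningMap.ext (LinearMap.ext fun v => ht h v)))
    (fun v => hcovN v) q i y hy

include hinj ht hcovN in
/-- **Cohomology of a directed union of lattices, injectivity half.**  If `N = ⋃_i N_i` (directed,
`L`-stable, `φ_i : N_i ↪ N`), the `Γ`-orbits on `𝒢 ⧸ L` admit a finite complete system `s` of
representatives, and each stabiliser `Γ_x`, `x ∈ s`, is of type `FP_∞` over `A`, then a class of
`H^q(Γ, indFun σ_{N_i})` mapping to `0` in `H^q(Γ, indFun σ_N)` maps to `0` in
`H^q(Γ, indFun σ_{N_j})` for some `j ≥ i`. [cite: Scholze2015, §V.4 (proof of Thm. V.4.1)]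
[cite: Brown1982CohomologyGroups, VIII (4.6)] -/
theorem exists_map_indFunMap_eq_zero_of_directed (s : Finset 𝒢)
    (hdisj : ∀ x ∈ s, ∀ y ∈ s, (∃ γ : Γ, ι γ • (x : 𝒢 ⧸ L) = (y : 𝒢 ⧸ L)) → x = y)
    (hcov : ∀ g : 𝒢, ∃ x ∈ s, ∃ γ : Γ, ι γ • (x : 𝒢 ⧸ L) = (g : 𝒢 ⧸ L))
    (hFP : ∀ x ∈ s, ∃ Px : ProjectiveResolution (Rep.trivial A (orbitStabilizer ι L (x : 𝒢 ⧸ L)) A),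
      ∀ n, ∃ m : ℕ, Nonempty (Px.complex.X n ≅ Rep.free A (orbitStabilizer ι L (x : 𝒢 ⧸ L)) (Fin m)))
    (q : ℕ) (i : ι') (y : groupCohomology (indFun ι L (σst i)) q)
    (hy : groupCohomology.map (MonoidHom.id Γ) (indFunMap ι L (σst i) σ (φ i)) q y = 0) :
    ∃ j, ∃ h : i ≤ j,
      groupCohomology.map (MonoidHom.id Γ) (indFunMap ι L (σst i) (σst j) (t h)) q y = 0 := by
  classical
  let P : ProjectiveResolution (Rep.trivial A Γ A) := Rep.barResolution A Γ
  -- per orbit: the `x`-component of `y` dies at some stage `j x ≥ i`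
  have hx : ∀ x ∈ s, ∃ j, ∃ h : i ≤ j, groupCohomology.map (MonoidHom.id _)
      (indStabMap ι L (σst i) (σst j) x (t h)) q (indToOrbitCohomologyNat ι L (σst i) x P q y) = 0 := by
    intro x hx
    obtain ⟨Px, hPx⟩ := hFP x hx
    refine exists_map_indStabMap_eq_zero_of_directed ι L σ σst φ hinj t ht hcovN x Px hPx q i _ ?_
    rw [← indToOrbitCohomologyNat_map_indFunMap, hy, map_zero]
  choose j hij hj using hx
  -- a common stage `J`
  have hJ' : ∃ J, i ≤ J ∧ ∀ (x : 𝒢) (hx : x ∈ s), j x hx ≤ J := by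
    obtain ⟨J, hJ⟩ := Finset.exists_le (insert i (s.attach.image fun x : {x // x ∈ s} => j x.1 x.2))
    exact ⟨J, hJ _ (Finset.mem_insert_self _ _), fun x hx => hJ _ (Finset.mem_insert_of_mem
      (Finset.mem_image.2 ⟨⟨x, hx⟩, Finset.mem_attach _ _, rfl⟩))⟩
  obtain ⟨J, hiJ, hjJ⟩ := hJ'
  refine ⟨J, hiJ, ?_⟩
  -- all components of `t_{iJ *} y` vanish
  have hcompx : ∀ (x : 𝒢) (hx : x ∈ s), groupCohomology.map (MonoidHom.id _)
      (indStabMap ι L (σst i) (σst J) x (t hiJ)) q (indToOrbitCohomologyNat ι L (σst i) x P q y) = 0 := by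
    intro x hx
    have hfac : indStabMap ι L (σst i) (σst J) x (t hiJ) =
        indStabMap ι L (σst i) (σst (j x hx)) x (t (hij x hx)) ≫
          indStabMap ι L (σst (j x hx)) (σst J) x (t (hjJ x hx)) :=
      Rep.hom_ext (Representation.IntertwiningMap.ext (LinearMap.ext fun v =>
        (transition_comp L σ σst φ hinj t ht (hij x hx) (hjJ x hx) v).symm))
    rw [hfac, groupCohomology.map_id_comp, ModuleCat.comp_apply, hj x hx, map_zero]
  apply (indToOrbitCohomologyNat_pi_bijective ι L (σst J) P s hdisj hcov q).1
  funext x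
  simp only
  rw [indToOrbitCohomologyNat_map_indFunMap, hcompx x.1 x.2, map_zero]

end TwistedQuotient

end Literature.NumberTheory.Automorphic
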